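import Summits.SmoothPoincare4.SmoothPoincare4.Theorems.ConvexBisectionAcyclicBisectionExistsKasOpenBook
import Literature.Geometry.Manifold.OpenSubmanifoldMFDeriv
import HarnessLib

/-!
# The seam page function, II: the page-angle reading `w ∘ jA⁻¹` on the unsurgered seam
(brick X5-2 of clause (ii) "the seam page function `F : ∂X₁ → ℂ`" of the registered stub
`stub_T3_dualPresentation` (T3), line `modp-braid-orbits`, crux `ConvexBisection.AcyclicBisectionExists`,
item stmt-SmoothPoincare4-10508; wave 5, lead c5)

For ANY multi-attachment `D : MultiAttachmentData h (𝓡∂ 4) X` of 2-handles on the standard base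
`Base g` and any boundary datum `bX` of `X`, the **page-angle reading**
`F₀ = w ∘ (D.jA)⁻¹ ∘ bX.incl : ∂X → ℂ` (honest on the open UNSURGERED part
`U = {y | bX.incl y ∈ range D.jA}` of `∂X`, junk elsewhere) has the three properties the seam page
function of T3 needs (`exists_seamReading`):

* VALUE: `bX.incl y = D.jA a ⇒ F₀ y = w (a)` (clause K2 of `IsKasOpenBookOf` with constant `1`);
* SMOOTH on `U` (the inverse chart of the open smooth embedding `D.jA`,
  `contMDiffOn_openEmbeddingChart_symm`, composed with `bX.incl`, the inclusions and `w`);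
* `d(arg F₀) ≠ 0` off the binding: `w(a) ≠ 0 ⇒ ∃ v, Im(conj(F₀ y) · dF₀_y v) ≠ 0` — W5's
  `angularDeriv_proj_ne_zero` on `∂ Base g`, rewritten by V1's `angularDeriv_argProj` as
  `Im(conj w · dw(u)) ≠ 0`, and transported to `∂X` along V1's local diffeomorphism
  `seamTheta h D bX : ∂Base g ∖ ⋃ cores → ∂X` by the chain rule (`F₀ ∘ seamTheta = w ∘ inclB`).

Also `isOpen_seamSet` and `exists_im_conj_mul_mfderiv_w_ne_zero` (the base case), and the
registered helper `helper_exists_seamReading`.  Everything here is proved; no named facts, no `def`.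

## References
* A. Kas, *On the handlebody decomposition associated to a Lefschetz fibration*, Pacific J. Math. 89
  (1980). [Kas1980]
* J. B. Etnyre, T. Fuller, IMRN 2006, §2. [EtnyreFuller2006]
-/

noncomputable section

-- the prescribed namespace `Summit.<P>.<Sub>.…` duplicates `SmoothPoincare4` (P = Sub)
set_option linter.dupNamespace false

open scoped Manifold ContDiff Topology

namespace Summit.SmoothPoincare4.SmoothPoincare4.Theorems.AcyclicBisectionExists.ModpBraidOrbits

open Set Function
open Literature.Topology.FourManifolds Literature.Topology.FourManifolds.HandleAttachingMap
  Literature.Topology.FourManifolds.LefschetzBase Literature.Geometry.Symplectic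

universe u v

/-! ### §1 The base case: `d(arg w) ≠ 0` on `∂ Base g` off the binding -/

/-- **On `∂ Base g`, off the binding `w = 0`, the argument of `w` has a non-zero differential**:
`∃ u, Im(conj(w) · dw(u)) ≠ 0` (W5's `angularDeriv_proj_ne_zero`, the angular differential of
`proj g = w/‖w‖` being `‖w‖⁻² Im(conj w · dw)` by V1's `angularDeriv_argProj`). [cite: EtnyreFuller2006, §2] -/
theorem exists_im_conj_mul_mfderiv_w_ne_zero (g : ℕ) {y : (bBase g).carrier}
    (hw : w g (inclB g y) ≠ 0) :
    ∃ u : EuclideanSpace ℝ (Fin 3), ((starRingEnd ℂ) (w g (inclB g y)) *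
      @id ℂ (mfderiv (𝓡 3) 𝓘(ℝ, ℂ) (fun y : (bBase g).carrier => w g (inclB g y)) y u)).im ≠ 0 := by
  have hne : angularDeriv (argProj fun y : (bBase g).carrier => w g (inclB g y)) y ≠ 0 :=
    angularDeriv_proj_ne_zero g hw
  obtain ⟨u, hu⟩ : ∃ u, angularDeriv (argProj fun y : (bBase g).carrier => w g (inclB g y)) y u ≠ 0 := by
    by_contra hcon
    push Not at hcon
    exact hne (ContinuousLinearMap.ext hcon)
  refine ⟨u, fun h0 => hu ?_⟩
  rw [angularDeriv_argProj (contMDiff_w_inclB g) hw, h0, mul_zero]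

/-! ### §2 The page-angle reading of a multi-attachment on its unsurgered seam -/

section SeamReading

variable {g : ℕ} {ι : Type v} [Finite ι] {h : ι → HandleAttachingMap 3 2 (Base g)}
  {X : Type u} [TopologicalSpace X] [ChartedSpace (EuclideanHalfSpace 4) X]
  (D : MultiAttachmentData h (𝓡∂ 4) X) (bX : BoundaryData (𝓡∂ 4) X (𝓡 3))

/-- **The unsurgered part `{y | bX.incl y ∈ range D.jA}` of `∂X` is open.** [folklore] -/
theorem isOpen_seamSet : IsOpen {y : bX.carrier | bX.incl y ∈ range D.jA} :=
  D.hjAo.preimage bX.continuous_incl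

/-- A seam point `bX.incl y = D.jA a` comes from a point of the unsurgered boundary of the base:
`a = seamBasePt h yb`. [folklore] -/
theorem exists_seamBasePt_eq_of_incl_eq {y : bX.carrier} {a : ↥(coresComplement h)}
    (hy : bX.incl y = D.jA a) : ∃ yb : ↥(seamDomain h), seamBasePt h yb = a := by
  have hb : D.jA a ∈ (𝓡∂ 4).boundary X := by
    rw [← hy, ← bX.range_incl]; exact mem_range_self y
  exact mem_range_seamBasePt h ((mem_boundary_iff_of_isSmoothEmbedding D.hjA D.hjAo a).1 hb)

/-- **THE PAGE-ANGLE READING `F₀ = w ∘ jA⁻¹ ∘ incl` of a multi-attachment on its unsurgered seam**: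
a function `F₀ : ∂X → ℂ` with `F₀ y = w(a)` whenever `bX.incl y = D.jA a`, smooth on the open set
`{y | bX.incl y ∈ range D.jA}`, and with `Im(conj(F₀ y) · dF₀_y v) ≠ 0` for some `v` at every such point
off the binding (`w(a) ≠ 0`). [cite: Kas1980] -/
theorem exists_seamReading :
    ∃ F₀ : bX.carrier → ℂ,
      (∀ (y : bX.carrier) (a : ↥(coresComplement h)), bX.incl y = D.jA a → F₀ y = w g (a : Base g).1) ∧
      ContMDiffOn (𝓡 3) 𝓘(ℝ, ℂ) ∞ F₀ {y | bX.incl y ∈ range D.jA} ∧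
      (∀ (y : bX.carrier) (a : ↥(coresComplement h)), bX.incl y = D.jA a → w g (a : Base g).1 ≠ 0 →
        ∃ v : EuclideanSpace ℝ (Fin 3),
          ((starRingEnd ℂ) (F₀ y) * @id ℂ (mfderiv (𝓡 3) 𝓘(ℝ, ℂ) F₀ y v)).im ≠ 0) := by
  classical
  rcases isEmpty_or_nonempty ↥(coresComplement h) with hE | hne
  · exact ⟨fun _ => 0, fun y a => (hE.false a).elim, contMDiffOn_const, fun y a => (hE.false a).elim⟩
  set H := openEmbeddingChart D.hjA D.hjAo with hH
  set wC : ↥(coresComplement h) → ℂ := fun a => w g (a : Base g).1 with hwC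
  have hwC : ContMDiff (𝓡∂ 4) 𝓘(ℝ, ℂ) ∞ wC :=
    (contDiff_w g).contMDiff.comp
      ((RegularSublevel.contMDiff_incl (isRegularLevel_rho g)).comp contMDiff_subtype_val)
  set F₀ : bX.carrier → ℂ := fun y => wC (H.symm (bX.incl y)) with hF₀
  have hval : ∀ (y : bX.carrier) (a : ↥(coresComplement h)), bX.incl y = D.jA a →
      F₀ y = w g (a : Base g).1 := by
    intro y a hy
    show wC (H.symm (bX.incl y)) = _
    rw [hy, hH, openEmbeddingChart_symm_apply]
  have hsm : ContMDiffOn (𝓡 3) 𝓘(ℝ, ℂ) ∞ F₀ {y | bX.incl y ∈ range D.jA} := by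
    have h1 : ContMDiffOn (𝓡 3) (𝓡∂ 4) ∞ (fun y => H.symm (bX.incl y)) {y | bX.incl y ∈ range D.jA} := by
      refine (contMDiffOn_openEmbeddingChart_symm D.hjA D.hjAo).comp
        bX.isSmoothEmbedding.contMDiff.contMDiffOn ?_
      intro y hy
      rw [mem_preimage, openEmbeddingChart_target]
      exact hy
    exact hwC.comp_contMDiffOn h1
  refine ⟨F₀, hval, hsm, ?_⟩
  intro y₀ a hy hw
  -- the base point `y'` under `a`, and V1's local diffeomorphism `Θ = seamTheta`
  obtain ⟨yb, hyb⟩ := exists_seamBasePt_eq_of_incl_eq D bX hy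
  haveI : Nonempty bX.carrier := ⟨y₀⟩
  haveI : Nonempty ↥(seamDomain h) := ⟨yb⟩
  have ha : inclB g yb.1 = (a : Base g).1 := congrArg (fun b : ↥(coresComplement h) => (b : Base g).1) hyb
  have hw' : w g (inclB g yb.1) ≠ 0 := by rwa [ha]
  have hΘ : seamTheta h D bX yb = y₀ := by
    apply bX.injective_incl
    rw [incl_seamTheta, hyb, ← hy]
  have hcomp : (F₀ ∘ seamTheta h D bX) =
      (fun y : (bBase g).carrier => w g (inclB g y)) ∘ (Subtype.val : ↥(seamDomain h) → _) := by
    funext z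
    rw [comp_apply, hval _ _ (incl_seamTheta h D bX z)]
    rfl
  -- the base case at `y'`
  obtain ⟨u, hu⟩ := exists_im_conj_mul_mfderiv_w_ne_zero g hw'
  -- differentiability
  have hF₀d : MDifferentiableAt (𝓡 3) 𝓘(ℝ, ℂ) F₀ (seamTheta h D bX yb) := by
    rw [hΘ]
    exact (hsm.contMDiffAt ((isOpen_seamSet D bX).mem_nhds (show bX.incl y₀ ∈ range D.jA from
      ⟨a, hy.symm⟩))).mdifferentiableAt (by simp)
  have hΘd : MDifferentiableAt (𝓡 3) (𝓡 3) (seamTheta h D bX) yb :=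
    (isSmoothEmbedding_seamTheta h D bX).1.contMDiff.contMDiffAt.mdifferentiableAt (by simp)
  have hwd : MDifferentiableAt (𝓡 3) 𝓘(ℝ, ℂ) (fun y : (bBase g).carrier => w g (inclB g y)) yb.1 :=
    (contMDiff_w_inclB g).contMDiffAt.mdifferentiableAt (by simp)
  have hvd : MDifferentiableAt (𝓡 3) (𝓡 3) (Subtype.val : ↥(seamDomain h) → (bBase g).carrier) yb :=
    Literature.Geometry.Manifold.OpenSubmanifold.mdifferentiableAt_subtype_val yb
  -- the chain rule on both sides of `F₀ ∘ Θ = (w ∘ inclB) ∘ val`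
  have e1 : mfderiv (𝓡 3) 𝓘(ℝ, ℂ) (F₀ ∘ seamTheta h D bX) yb u =
      mfderiv (𝓡 3) 𝓘(ℝ, ℂ) F₀ y₀ (mfderiv (𝓡 3) (𝓡 3) (seamTheta h D bX) yb u) := by
    rw [mfderiv_comp yb hF₀d hΘd, hΘ]
    rfl
  have e2 : mfderiv (𝓡 3) 𝓘(ℝ, ℂ) (F₀ ∘ seamTheta h D bX) yb u =
      mfderiv (𝓡 3) 𝓘(ℝ, ℂ) (fun y : (bBase g).carrier => w g (inclB g y)) yb.1 u := by
    rw [hcomp, mfderiv_comp yb hwd hvd, Literature.Geometry.Manifold.OpenSubmanifold.mfderiv_subtype_val]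
    rfl
  refine ⟨mfderiv (𝓡 3) (𝓡 3) (seamTheta h D bX) yb u, ?_⟩
  have hF₀y : F₀ y₀ = w g (inclB g yb.1) := by rw [hval y₀ a hy, ha]
  have hd : @id ℂ (mfderiv (𝓡 3) 𝓘(ℝ, ℂ) F₀ y₀ (mfderiv (𝓡 3) (𝓡 3) (seamTheta h D bX) yb u)) =
      @id ℂ (mfderiv (𝓡 3) 𝓘(ℝ, ℂ) (fun y : (bBase g).carrier => w g (inclB g y)) yb.1 u) := by
    rw [← e1, e2]
  rw [hd, hF₀y]
  exact hu

end SeamReading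

/-! ### §3 Registered helper -/

/-- **Registered helper `helper_exists_seamReading` (sub-goal of `stub_T3_dualPresentation`, T3 clause
(ii), brick X5-2, wave 5, lead c5): the page-angle reading of a multi-attachment on its unsurgered
seam** — value `w(a)`, smooth on the unsurgered part, `d(arg) ≠ 0` off the binding. [cite: Kas1980] -/
theorem helper_exists_seamReading : ∀ {g : ℕ} {ι : Type} [Finite ι] {h : ι → Literature.Topology.FourManifolds.HandleAttachingMap 3 2 (Literature.Topology.FourManifolds.LefschetzBase.Base g)} {X : Type} [TopologicalSpace X] [ChartedSpace (EuclideanHalfSpace 4) X] (D : Literature.Topology.FourManifolds.HandleAttachingMap.MultiAttachmentData h (𝓡∂ 4) X) (bX : Literature.Topology.FourManifolds.BoundaryData (𝓡∂ 4) X (𝓡 3)), ∃ F₀ : bX.carrier → ℂ, (∀ (y : bX.carrier) (a : ↥(Literature.Topology.FourManifolds.HandleAttachingMap.coresComplement h)), bX.incl y = D.jA a → F₀ y = Literature.Topology.FourManifolds.LefschetzBase.w g (a : Literature.Topology.FourManifolds.LefschetzBase.Base g).1) ∧ ContMDiffOn (𝓡 3) 𝓘(ℝ, ℂ) ∞ F₀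 {y | bX.incl y ∈ Set.range D.jA} ∧ (∀ (y : bX.carrier) (a : ↥(Literature.Topology.FourManifolds.HandleAttachingMap.coresComplement h)), bX.incl y = D.jA a → Literature.Topology.FourManifolds.LefschetzBase.w g (a : Literature.Topology.FourManifolds.LefschetzBase.Base g).1 ≠ 0 → ∃ v : EuclideanSpace ℝ (Fin 3), ((starRingEnd ℂ) (F₀ y) * @id ℂ (mfderiv (𝓡 3) 𝓘(ℝ, ℂ) F₀ y v)).im ≠ 0) :=
  fun D bX => exists_seamReading D bX

end Summit.SmoothPoincare4.SmoothPoincare4.Theorems.AcyclicBisectionExists.ModpBraidOrbits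

end
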